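import Literature.AlgebraicGeometry.HodgeTheory.FermatHodgeCharacterUGroup
import HarnessLib

/-!
# The peeling calculus for point configurations annihilated by all primitive characters

Support file IX (everything PROVED; no named facts, no definitions) for the structure theorem of
the Hodge characters of the Fermat surface (`AokiShioda1983_thmB2m_standard`).

A *configuration* at level `N` is a finite family of units `pᵢ ∈ (ℤ/N)ˣ` with coefficients
`cᵢ ∈ ℂ`; it is *null* if `∑ cᵢ χ(pᵢ) = 0` for EVERY primitive Dirichlet character `χ` mod `N`
(both parities). For `N = q · n` coprime, `q = p^e`, `U_q = ker((ℤ/q)ˣ → (ℤ/(q/p))ˣ)`, and a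
primitive `χ₂` mod `n`, the *slice function* is
`F_{χ₂}(r) = ∑_{i : pᵢ ≡ r (q)} cᵢ χ₂(pᵢ mod n)` (`r ∈ ℤ/q`).

* `sum_prodChar_points` — `∑ cᵢ (χ₁ ⊠ χ₂)(pᵢ) = ∑_r χ₁(r) F_{χ₂}(r)`;
* `slice_invariant` (**PEEL**) — for a null configuration every slice function is
  `U_q`-invariant (the local Fourier lemma `parityPart_mul_eq_of_orthogonal` for both parities);
* `null_of_slice_invariant` (**LIFT**) — conversely, `U_q`-invariance of all slice functions
  makes the configuration null at level `q n`;
* `slice_null_of_free` — if the coset `r U_q` is not contained in the residues of the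
  configuration, the slice at `r` is itself a null configuration at level `n`;
* `exists_isPrimitive` — levels `n` odd or divisible by `4` carry primitive characters.

This replaces Aoki's normalized expansions and the structure of the ideals
`𝓘⁻ = 𝓢⁻ + 𝓣⁻` ([Aoki1983, §§3–4]) by an induction on the level.

## References

* [Aoki1983] N. Aoki, On some arithmetic problems related to the Hodge cycles on the Fermat
  varieties, Math. Ann. 266 (1983) 23–54, §§3–4 (text read).
-/

noncomputable section

open Finset

namespace Literature.AlgebraicGeometry.HodgeTheory

namespace FermatCharacter

section Engine

variable {q n : ℕ} [NeZero q] [NeZero n]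

/-- **Regrouping by residues mod `q`.** `∑ cᵢ (χ₁ ⊠ χ₂)(pᵢ) = ∑_r χ₁(r) F_{χ₂}(r)`. [folklore] -/
theorem sum_prodChar_points {k : ℕ} (p : Fin k → (ZMod (q * n))ˣ) (c : Fin k → ℂ)
    (χ₁ : DirichletCharacter ℂ q) (χ₂ : DirichletCharacter ℂ n) :
    ∑ i, c i * (DirichletCharacter.changeLevel (dvd_mul_right q n) χ₁ *
        DirichletCharacter.changeLevel (dvd_mul_left n q) χ₂) (p i) =
      ∑ r : ZMod q, χ₁ r * ∑ i, (if ZMod.castHom (dvd_mul_right q n) (ZMod q) (p i) = r then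
        c i * χ₂ (ZMod.castHom (dvd_mul_left n q) (ZMod n) (p i)) else 0) := by
  classical
  simp_rw [prodChar_apply, Finset.mul_sum, mul_ite, mul_zero]
  rw [Finset.sum_comm]
  refine Finset.sum_congr rfl fun i _ ↦ ?_
  rw [Finset.sum_ite_eq]
  simp only [Finset.mem_univ, if_true]
  ring

/-- **PEEL.** For a configuration annihilated by all primitive characters mod `q n` and a
primitive `χ₂` mod `n`, the slice function `F_{χ₂}` is invariant under
`U = ker((ℤ/q)ˣ → (ℤ/d)ˣ)` (`d ∣ q`, characters mod `q` not factoring through `d` primitive).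
[cite: Aoki1983, Lemma 3.2 / Cor. 3.4] -/
theorem slice_invariant (h : q.Coprime n) {d : ℕ} (hd : d ∣ q)
    (hprim : ∀ χ : DirichletCharacter ℂ q, ¬ χ.FactorsThrough d → χ.IsPrimitive)
    {k : ℕ} (p : Fin k → (ZMod (q * n))ˣ) (c : Fin k → ℂ)
    (hT : ∀ χ : DirichletCharacter ℂ (q * n), χ.IsPrimitive → ∑ i, c i * χ (p i) = 0)
    (χ₂ : DirichletCharacter ℂ n) (hχ₂ : χ₂.IsPrimitive)
    (u y : (ZMod q)ˣ) (hu : ZMod.unitsMap hd u = 1) :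
    (∑ i, (if ZMod.castHom (dvd_mul_right q n) (ZMod q) (p i) = (u : ZMod q) * y then
        c i * χ₂ (ZMod.castHom (dvd_mul_left n q) (ZMod n) (p i)) else 0)) =
      ∑ i, (if ZMod.castHom (dvd_mul_right q n) (ZMod q) (p i) = y then
        c i * χ₂ (ZMod.castHom (dvd_mul_left n q) (ZMod n) (p i)) else 0) := by
  classical
  haveI : NeZero (q * n) := ⟨mul_ne_zero (NeZero.ne q) (NeZero.ne n)⟩
  set F : ZMod q → ℂ := fun r ↦ ∑ i, (if ZMod.castHom (dvd_mul_right q n) (ZMod q) (p i) = r then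
      c i * χ₂ (ZMod.castHom (dvd_mul_left n q) (ZMod n) (p i)) else 0) with hF
  have horth : ∀ ε : ℂ, ∀ χ : DirichletCharacter ℂ q, χ (-1) = ε → ¬ χ.FactorsThrough d →
      ∑ x : ZMod q, F x * χ x = 0 := by
    intro ε χ _ hχ
    have key := hT _ (prodChar_isPrimitive h (hprim χ hχ) hχ₂)
    rw [sum_prodChar_points] at key
    rw [← key]
    exact Finset.sum_congr rfl fun r _ ↦ mul_comm _ _
  have h1 := parityPart_mul_eq_of_orthogonal hd F (Or.inl rfl) (horth 1) u y hu
  have h2 := parityPart_mul_eq_of_orthogonal hd F (Or.inr rfl) (horth (-1)) u y hu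
  have : (2 : ℂ) * F ((u : ZMod q) * y) = 2 * F y := by linear_combination h1 + h2
  have h3 : F ((u : ZMod q) * y) = F y := by
    have := mul_left_cancel₀ (two_ne_zero (α := ℂ)) this
    exact this
  exact h3

/-- **LIFT.** If every slice function is `U`-invariant (`U = ker((ℤ/q)ˣ → (ℤ/d)ˣ)`,
`d ∣ q`, `d ≠ q`), the configuration is annihilated by all primitive characters mod `q n`.
[cite: Aoki1983, §4] -/
theorem null_of_slice_invariant (h : q.Coprime n) {d : ℕ} (hd : d ∣ q) (hdq : d ≠ q)
    {k : ℕ} (p : Fin k → (ZMod (q * n))ˣ) (c : Fin k → ℂ)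
    (hinv : ∀ χ₂ : DirichletCharacter ℂ n, χ₂.IsPrimitive → ∀ u y : (ZMod q)ˣ,
      ZMod.unitsMap hd u = 1 →
      (∑ i, (if ZMod.castHom (dvd_mul_right q n) (ZMod q) (p i) = (u : ZMod q) * y then
          c i * χ₂ (ZMod.castHom (dvd_mul_left n q) (ZMod n) (p i)) else 0)) =
        ∑ i, (if ZMod.castHom (dvd_mul_right q n) (ZMod q) (p i) = y then
          c i * χ₂ (ZMod.castHom (dvd_mul_left n q) (ZMod n) (p i)) else 0))
    (χ : DirichletCharacter ℂ (q * n)) (hχ : χ.IsPrimitive) : ∑ i, c i * χ (p i) = 0 := by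
  classical
  haveI : NeZero (q * n) := ⟨mul_ne_zero (NeZero.ne q) (NeZero.ne n)⟩
  obtain ⟨χ₁, χ₂, rfl, hp⟩ := exists_eq_prodChar h χ
  obtain ⟨h1, h2⟩ := hp hχ
  set F : ZMod q → ℂ := fun r ↦ ∑ i, (if ZMod.castHom (dvd_mul_right q n) (ZMod q) (p i) = r then
      c i * χ₂ (ZMod.castHom (dvd_mul_left n q) (ZMod n) (p i)) else 0) with hF
  rw [sum_prodChar_points]
  change ∑ r : ZMod q, χ₁ r * F r = 0
  obtain ⟨u, hu, hχu⟩ := exists_ker_apply_ne_one hd (not_factorsThrough_of_isPrimitive hd hdq h1)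
  -- `F (u r) = F r` for every `r`
  have hFu : ∀ r : ZMod q, F ((u : ZMod q) * r) = F r := by
    intro r
    by_cases hr : IsUnit r
    · have := hinv χ₂ h2 u hr.unit hu
      rw [IsUnit.unit_spec] at this
      exact this
    · -- both sides vanish: the residues of the `pᵢ` are units
      have hz : ∀ s : ZMod q, ¬ IsUnit s → F s = 0 := by
        intro s hs
        rw [hF]
        refine Finset.sum_eq_zero fun i _ ↦ ?_
        rw [if_neg]
        intro he
        apply hs
        rw [← he]
        exact (Units.isUnit (p i)).map _
      rw [hz r hr, hz _ (fun hur ↦ hr ?_)]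
      have := (Units.isUnit u⁻¹).mul hur
      rwa [← mul_assoc, Units.inv_mul, one_mul] at this
  -- reindex the sum by `r ↦ u r`
  have hS : ∑ r : ZMod q, χ₁ r * F r = χ₁ u * ∑ r : ZMod q, χ₁ r * F r := by
    rw [Finset.mul_sum]
    rw [← Equiv.sum_comp (Units.mulLeft u) (fun r ↦ χ₁ r * F r)]
    refine Finset.sum_congr rfl fun r _ ↦ ?_
    simp only [Units.mulLeft_apply]
    rw [map_mul, hFu r]
    ring
  have : (1 - χ₁ u) * ∑ r : ZMod q, χ₁ r * F r = 0 := by linear_combination hS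
  rcases mul_eq_zero.mp this with h0 | h0
  · exact absurd (by linear_combination -h0) hχu
  · exact h0

/-- **Free residue ⟹ null slice.** If some `u ∈ U` moves the residue `r` off the residues of
the configuration, the slice at `r` is annihilated by every primitive character mod `n`.
[cite: Aoki1983, Cor. 3.4] -/
theorem slice_null_of_free (h : q.Coprime n) {d : ℕ} (hd : d ∣ q)
    (hprim : ∀ χ : DirichletCharacter ℂ q, ¬ χ.FactorsThrough d → χ.IsPrimitive)
    {k : ℕ} (p : Fin k → (ZMod (q * n))ˣ) (c : Fin k → ℂ)
    (hT : ∀ χ : DirichletCharacter ℂ (q * n), χ.IsPrimitive → ∑ i, c i * χ (p i) = 0)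
    (r u : (ZMod q)ˣ) (hu : ZMod.unitsMap hd u = 1)
    (hfree : ∀ i, ZMod.castHom (dvd_mul_right q n) (ZMod q) (p i) ≠ (u : ZMod q) * r)
    (χ₂ : DirichletCharacter ℂ n) (hχ₂ : χ₂.IsPrimitive) :
    (∑ i, (if ZMod.castHom (dvd_mul_right q n) (ZMod q) (p i) = r then
        c i * χ₂ (ZMod.castHom (dvd_mul_left n q) (ZMod n) (p i)) else 0)) = 0 := by
  classical
  rw [← slice_invariant h hd hprim p c hT χ₂ hχ₂ u r hu]
  exact Finset.sum_eq_zero fun i _ ↦ if_neg (hfree i)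

omit [NeZero q] in
/-- Levels `n` odd or divisible by `4` carry primitive characters. [cite: Aoki1983, §3 (p. 28)] -/
theorem exists_isPrimitive (hval : Odd n ∨ 4 ∣ n) : ∃ χ : DirichletCharacter ℂ n, χ.IsPrimitive := by
  by_cases h34 : n = 3 ∨ n = 4
  · have h1 : n ≠ 1 := by rcases h34 with rfl | rfl <;> norm_num
    have h12 : n ≠ 12 := by rcases h34 with rfl | rfl <;> norm_num
    obtain ⟨χ, -, hχ⟩ := exists_odd_isPrimitive hval h1 h12
    exact ⟨χ, hχ⟩
  · rw [not_or] at h34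
    obtain ⟨χ, -, hχ⟩ := exists_even_isPrimitive hval h34.1 h34.2
    exact ⟨χ, hχ⟩

end Engine

/-! ### Two-point configurations: the three consequences of one peeling step -/

section TwoPoint

variable {q m : ℕ} [NeZero q] [NeZero m]

omit [NeZero q] [NeZero m] in
/-- The slice sums of the two-point configuration `(1) - σ (w)`. [folklore] -/
theorem slice_two_point (w : (ZMod (q * m))ˣ) (σ : ℂ) (χ₂ : DirichletCharacter ℂ m)
    (r : ZMod q) :
    (∑ i : Fin 2, (if ZMod.castHom (dvd_mul_right q m) (ZMod q) ((![1, w] i : (ZMod (q * m))ˣ)) = r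
        then ![(1 : ℂ), -σ] i * χ₂ (ZMod.castHom (dvd_mul_left m q) (ZMod m) ((![1, w] i :
          (ZMod (q * m))ˣ))) else 0)) =
      (if (1 : ZMod q) = r then 1 else 0) +
        (if ZMod.castHom (dvd_mul_right q m) (ZMod q) (w : ZMod (q * m)) = r then
          -σ * χ₂ (ZMod.castHom (dvd_mul_left m q) (ZMod m) (w : ZMod (q * m))) else 0) := by
  simp only [Fin.sum_univ_two, Matrix.cons_val_zero, Matrix.cons_val_one, Units.val_one, map_one,
    one_mul]

omit [NeZero q] [NeZero m] in
/-- The two-point configuration `(1) - σ (w)` is annihilated by all primitive characters when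
`χ(w) = σ = ±1` for all of them. [folklore] -/
theorem two_point_null (w : (ZMod (q * m))ˣ) {σ : ℂ} (hσ : σ = 1 ∨ σ = -1)
    (hw : ∀ χ : DirichletCharacter ℂ (q * m), χ.IsPrimitive → χ w = σ)
    (χ : DirichletCharacter ℂ (q * m)) (hχ : χ.IsPrimitive) :
    ∑ i : Fin 2, ![(1 : ℂ), -σ] i * χ ((![1, w] i : (ZMod (q * m))ˣ)) = 0 := by
  simp only [Fin.sum_univ_two, Matrix.cons_val_zero, Matrix.cons_val_one, Units.val_one, map_one,
    one_mul, hw χ hχ]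
  rcases hσ with rfl | rfl <;> norm_num

/-- (T1) A residue `w mod q ≠ 1` together with a free kernel element is contradictory.
[cite: Aoki1983, Cor. 3.4] -/
theorem two_point_false (h : q.Coprime m) {d : ℕ} (hd : d ∣ q)
    (hprim : ∀ χ : DirichletCharacter ℂ q, ¬ χ.FactorsThrough d → χ.IsPrimitive)
    (hval : Odd m ∨ 4 ∣ m) (w : (ZMod (q * m))ˣ) {σ : ℂ} (hσ : σ = 1 ∨ σ = -1)
    (hw : ∀ χ : DirichletCharacter ℂ (q * m), χ.IsPrimitive → χ w = σ)
    (hwq : ZMod.castHom (dvd_mul_right q m) (ZMod q) (w : ZMod (q * m)) ≠ 1)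
    (u : (ZMod q)ˣ) (hu : ZMod.unitsMap hd u = 1) (hu1 : (u : ZMod q) ≠ 1)
    (huw : (u : ZMod q) ≠ ZMod.castHom (dvd_mul_right q m) (ZMod q) (w : ZMod (q * m))) :
    False := by
  classical
  obtain ⟨χ₂, hχ₂⟩ := exists_isPrimitive (n := m) hval
  have key := slice_null_of_free h hd hprim ![1, w] ![(1 : ℂ), -σ] (two_point_null w hσ hw)
    1 u hu ?_ χ₂ hχ₂
  · rw [slice_two_point, Units.val_one, if_pos rfl, if_neg hwq, add_zero] at key
    exact one_ne_zero key
  · intro i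
    fin_cases i
    · simpa using hu1.symm
    · simpa using huw.symm

/-- (T2) If `w ≡ 1 (mod q)` and the kernel is non-trivial, the condition descends to the
cofactor: `χ₂(w mod m) = σ` for every primitive `χ₂` mod `m`. [cite: Aoki1983, Cor. 3.4] -/
theorem two_point_recurse (h : q.Coprime m) {d : ℕ} (hd : d ∣ q)
    (hprim : ∀ χ : DirichletCharacter ℂ q, ¬ χ.FactorsThrough d → χ.IsPrimitive)
    (w : (ZMod (q * m))ˣ) {σ : ℂ} (hσ : σ = 1 ∨ σ = -1)
    (hw : ∀ χ : DirichletCharacter ℂ (q * m), χ.IsPrimitive → χ w = σ)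
    (hwq : ZMod.castHom (dvd_mul_right q m) (ZMod q) (w : ZMod (q * m)) = 1)
    (u : (ZMod q)ˣ) (hu : ZMod.unitsMap hd u = 1) (hu1 : (u : ZMod q) ≠ 1)
    (χ₂ : DirichletCharacter ℂ m) (hχ₂ : χ₂.IsPrimitive) :
    χ₂ (ZMod.castHom (dvd_mul_left m q) (ZMod m) (w : ZMod (q * m))) = σ := by
  classical
  have key := slice_null_of_free h hd hprim ![1, w] ![(1 : ℂ), -σ] (two_point_null w hσ hw)
    1 u hu ?_ χ₂ hχ₂
  · rw [slice_two_point, Units.val_one, if_pos rfl, if_pos hwq] at key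
    rcases hσ with rfl | rfl
    · linear_combination -key
    · linear_combination key
  · intro i
    fin_cases i
    · simpa using hu1.symm
    · simp [hwq]; exact hu1.symm

/-- (T3) If `w mod q` is a non-trivial kernel element `u`, the slices at `1` and `u` agree:
`χ₂(w mod m) = -σ` for every primitive `χ₂` mod `m`. [cite: Aoki1983, Cor. 3.4] -/
theorem two_point_coset (h : q.Coprime m) {d : ℕ} (hd : d ∣ q)
    (hprim : ∀ χ : DirichletCharacter ℂ q, ¬ χ.FactorsThrough d → χ.IsPrimitive)
    (w : (ZMod (q * m))ˣ) {σ : ℂ} (hσ : σ = 1 ∨ σ = -1)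
    (hw : ∀ χ : DirichletCharacter ℂ (q * m), χ.IsPrimitive → χ w = σ)
    (u : (ZMod q)ˣ) (hu : ZMod.unitsMap hd u = 1) (hu1 : (u : ZMod q) ≠ 1)
    (hwq : ZMod.castHom (dvd_mul_right q m) (ZMod q) (w : ZMod (q * m)) = u)
    (χ₂ : DirichletCharacter ℂ m) (hχ₂ : χ₂.IsPrimitive) :
    χ₂ (ZMod.castHom (dvd_mul_left m q) (ZMod m) (w : ZMod (q * m))) = -σ := by
  classical
  have key := slice_invariant h hd hprim ![1, w] ![(1 : ℂ), -σ] (two_point_null w hσ hw)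
    χ₂ hχ₂ u 1 hu
  rw [slice_two_point, slice_two_point, Units.val_one, mul_one, if_neg hu1.symm, hwq, if_pos rfl,
    if_pos rfl, if_neg hu1, zero_add, add_zero] at key
  rcases hσ with rfl | rfl
  · linear_combination -key
  · linear_combination key

end TwoPoint

/-! ### `U*(n)` and `U**(n)`: units on which all primitive characters are `1`, resp. `-1` -/

section UStar

/-- `m² ≡ 1 (mod 3)` for `m` coprime to `3`. [folklore] -/
theorem natCast_sq_three {m : ℕ} (h : ¬ 3 ∣ m) : ((m : ℕ) : ZMod 3) ^ 2 = 1 := by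
  have : (m : ZMod 3) ≠ 0 := by rw [Ne, ZMod.natCast_eq_zero_iff]; exact h
  generalize (m : ZMod 3) = y at this; revert y; decide

/-- A kernel with at least three elements has an element avoiding `1` and any given `t`.
[folklore] -/
theorem exists_ker_ne_ne {q d : ℕ} [NeZero q] (hd : d ∣ q)
    (h3 : 3 ≤ #(univ.filter fun u : (ZMod q)ˣ ↦ ZMod.unitsMap hd u = 1)) (t : (ZMod q)ˣ) :
    ∃ u : (ZMod q)ˣ, ZMod.unitsMap hd u = 1 ∧ u ≠ 1 ∧ u ≠ t := by
  classical
  set S := univ.filter fun u : (ZMod q)ˣ ↦ ZMod.unitsMap hd u = 1 with hS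
  have hcard : 0 < #((S.erase 1).erase t) := by
    have h1 := Finset.pred_card_le_card_erase (s := S) (a := 1)
    have h2 := Finset.pred_card_le_card_erase (s := S.erase 1) (a := t)
    omega
  obtain ⟨u, hu⟩ := Finset.card_pos.mp hcard
  simp only [hS, Finset.mem_erase, Finset.mem_filter, Finset.mem_univ, true_and] at hu
  exact ⟨u, hu.2.2, hu.2.1, hu.1⟩

/-- Reduction to level `1` is trivial on units. [folklore] -/
theorem unitsMap_eq_one_of_eq_one {q d : ℕ} (hd : d ∣ q) (hd1 : d = 1) (u : (ZMod q)ˣ) :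
    ZMod.unitsMap hd u = 1 := by
  subst hd1
  exact Subsingleton.elim _ _

/-- One peeling step for `U*`/`U**` at an odd prime power `q = p^e` whose kernel
`ker((ℤ/q)ˣ → (ℤ/p^(e-1))ˣ)` has at least three elements (`p ≥ 5`, or `p = 3`, `e ≥ 2`).
[cite: Aoki1983, §6] -/
theorem ustar_step_big {p e m : ℕ} [NeZero m] (hp : p.Prime) (hp2 : p ≠ 2) (he1 : 1 ≤ e)
    [NeZero (p ^ e)] (hcop : (p ^ e).Coprime m) (hmval : Odd m ∨ 4 ∣ m)
    (hker : 3 ≤ #(univ.filter fun u : (ZMod (p ^ e))ˣ ↦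
      ZMod.unitsMap (pow_dvd_pow p (Nat.sub_le e 1)) u = 1))
    (ih1 : ∀ w : (ZMod m)ˣ, (∀ χ : DirichletCharacter ℂ m, χ.IsPrimitive → χ w = 1) →
      (w : ZMod m) = 1 ∨ (4 ∣ m ∧ 3 ∣ m ∧ ¬ 9 ∣ m ∧
        (w : ZMod m) = (((m / 2 : ℕ) : ZMod m) - 1) * (2 * ((m / 3 : ℕ) : ZMod m) ^ 2 - 1)))
    (ih2 : ∀ w : (ZMod m)ˣ, (∀ χ : DirichletCharacter ℂ m, χ.IsPrimitive → χ w = -1) →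
      (4 ∣ m ∧ (w : ZMod m) = 1 + ((m / 2 : ℕ) : ZMod m)) ∨
      (3 ∣ m ∧ ¬ 9 ∣ m ∧ (w : ZMod m) = 1 - 2 * ((m / 3 : ℕ) : ZMod m) ^ 2)) :
    (∀ w : (ZMod (p ^ e * m))ˣ,
      (∀ χ : DirichletCharacter ℂ (p ^ e * m), χ.IsPrimitive → χ w = 1) →
      (w : ZMod (p ^ e * m)) = 1 ∨ (4 ∣ p ^ e * m ∧ 3 ∣ p ^ e * m ∧ ¬ 9 ∣ p ^ e * m ∧
        (w : ZMod (p ^ e * m)) = (((p ^ e * m / 2 : ℕ) : ZMod (p ^ e * m)) - 1) *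
          (2 * ((p ^ e * m / 3 : ℕ) : ZMod (p ^ e * m)) ^ 2 - 1))) ∧
    (∀ w : (ZMod (p ^ e * m))ˣ,
      (∀ χ : DirichletCharacter ℂ (p ^ e * m), χ.IsPrimitive → χ w = -1) →
      (4 ∣ p ^ e * m ∧ (w : ZMod (p ^ e * m)) = 1 + ((p ^ e * m / 2 : ℕ) : ZMod (p ^ e * m))) ∨
      (3 ∣ p ^ e * m ∧ ¬ 9 ∣ p ^ e * m ∧
        (w : ZMod (p ^ e * m)) = 1 - 2 * ((p ^ e * m / 3 : ℕ) : ZMod (p ^ e * m)) ^ 2)) := by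
  classical
  haveI : NeZero (p ^ e * m) := ⟨mul_ne_zero (NeZero.ne _) (NeZero.ne m)⟩
  have hd : p ^ (e - 1) ∣ p ^ e := pow_dvd_pow p (Nat.sub_le e 1)
  have hprim : ∀ χ : DirichletCharacter ℂ (p ^ e), ¬ χ.FactorsThrough (p ^ (e - 1)) →
      χ.IsPrimitive := fun χ hχ ↦ isPrimitive_of_not_factorsThrough_primePow hp he1 χ hχ
  have hqodd : Odd (p ^ e) := (hp.odd_of_ne_two hp2).pow
  have h3q : 3 ∣ m → ¬ 3 ∣ p ^ e := fun h3 hq ↦ by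
    have := Nat.Coprime.coprime_dvd_right h3 (Nat.Coprime.coprime_dvd_left hq hcop)
    norm_num at this
  have h9n : 3 ∣ m → ¬ 9 ∣ m → ¬ 9 ∣ p ^ e * m := fun h3 h9 h9n ↦ by
    have hc : Nat.Coprime (3 ^ 2) (p ^ e) :=
      Nat.Coprime.pow_left 2 ((Nat.Prime.coprime_iff_not_dvd Nat.prime_three).mpr (h3q h3))
    have hc' : Nat.Coprime 9 (p ^ e) := by norm_num at hc; exact hc
    exact h9 (hc'.dvd_of_dvd_mul_left h9n)
  have h2m : 4 ∣ m → 2 ∣ m := fun h ↦ dvd_trans ⟨2, rfl⟩ h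
  -- the generic step: either `w ≡ 1 (mod q)` and the condition descends, or contradiction
  have step : ∀ (σ : ℂ), (σ = 1 ∨ σ = -1) → ∀ w : (ZMod (p ^ e * m))ˣ,
      (∀ χ : DirichletCharacter ℂ (p ^ e * m), χ.IsPrimitive → χ w = σ) →
      ZMod.castHom (dvd_mul_right (p ^ e) m) (ZMod (p ^ e)) (w : ZMod (p ^ e * m)) = 1 ∧
        ∀ χ₂ : DirichletCharacter ℂ m, χ₂.IsPrimitive →
          χ₂ ((ZMod.unitsMap (dvd_mul_left m (p ^ e)) w : (ZMod m)ˣ) : ZMod m) = σ := by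
    intro σ hσ w hw
    by_cases hwq : ZMod.castHom (dvd_mul_right (p ^ e) m) (ZMod (p ^ e)) (w : ZMod (p ^ e * m)) = 1
    · obtain ⟨u, hu, hu1, -⟩ := exists_ker_ne_ne hd hker 1
      have hu1' : (u : ZMod (p ^ e)) ≠ 1 := fun h ↦ hu1 (Units.ext h)
      refine ⟨hwq, fun χ₂ hχ₂ ↦ ?_⟩
      rw [coe_unitsMap]
      exact two_point_recurse hcop hd hprim w hσ hw hwq u hu hu1' χ₂ hχ₂
    · exfalso
      obtain ⟨u, hu, hu1, hut⟩ := exists_ker_ne_ne hd hker (ZMod.unitsMap (dvd_mul_right (p ^ e) m) w)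
      have hu1' : (u : ZMod (p ^ e)) ≠ 1 := fun h ↦ hu1 (Units.ext h)
      have hut' : (u : ZMod (p ^ e)) ≠
          ZMod.castHom (dvd_mul_right (p ^ e) m) (ZMod (p ^ e)) (w : ZMod (p ^ e * m)) := by
        rw [← coe_unitsMap]; exact fun h ↦ hut (Units.ext h)
      exact two_point_false hcop hd hprim hmval w hσ hw hwq u hu hu1' hut'
  constructor
  · intro w hw
    obtain ⟨hwq, hrec⟩ := step 1 (Or.inl rfl) w hw
    rcases ih1 _ hrec with h1 | ⟨h4, h3, h9, huv⟩
    · left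
      exact eq_of_cast_eq_of_coprime hcop (by rw [hwq, map_one])
        (by rw [map_one, ← coe_unitsMap, h1])
    · right
      refine ⟨dvd_mul_of_dvd_right h4 _, dvd_mul_of_dvd_right h3 _, h9n h3 h9,
        eq_of_cast_eq_of_coprime hcop ?_ ?_⟩
      · rw [hwq, map_mul, castHom_left_uElt (h2m h4), castHom_left_vElt h3]; ring
      · rw [map_mul, castHom_right_uElt hqodd (h2m h4), castHom_right_vElt hcop h3, ← coe_unitsMap,
          huv]
  · intro w hw
    obtain ⟨hwq, hrec⟩ := step (-1) (Or.inr rfl) w hw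
    rcases ih2 _ hrec with ⟨h4, hh⟩ | ⟨h3, h9, hv⟩
    · left
      refine ⟨dvd_mul_of_dvd_right h4 _, eq_of_cast_eq_of_coprime hcop ?_ ?_⟩
      · rw [hwq, map_add, map_one, castHom_left_half (h2m h4), add_zero]
      · rw [map_add, map_one, castHom_right_half hqodd (h2m h4), ← coe_unitsMap, hh]
    · right
      refine ⟨dvd_mul_of_dvd_right h3 _, h9n h3 h9, eq_of_cast_eq_of_coprime hcop ?_ ?_⟩
      · rw [hwq, map_sub, map_one, map_mul, map_pow, castHom_left_third h3, map_ofNat]; ring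
      · rw [map_sub, map_one, map_mul, map_ofNat, castHom_right_third_sq hcop h3, ← coe_unitsMap,
          hv]

/-- One peeling step for `U*`/`U**` at the prime `3 ∥ n`. [cite: Aoki1983, §6] -/
theorem ustar_step_three {m : ℕ} [NeZero m] (hm3 : ¬ 3 ∣ m) (hcop : (3 ^ 1).Coprime m)
    (ih1 : ∀ w : (ZMod m)ˣ, (∀ χ : DirichletCharacter ℂ m, χ.IsPrimitive → χ w = 1) →
      (w : ZMod m) = 1 ∨ (4 ∣ m ∧ 3 ∣ m ∧ ¬ 9 ∣ m ∧
        (w : ZMod m) = (((m / 2 : ℕ) : ZMod m) - 1) * (2 * ((m / 3 : ℕ) : ZMod m) ^ 2 - 1)))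
    (ih2 : ∀ w : (ZMod m)ˣ, (∀ χ : DirichletCharacter ℂ m, χ.IsPrimitive → χ w = -1) →
      (4 ∣ m ∧ (w : ZMod m) = 1 + ((m / 2 : ℕ) : ZMod m)) ∨
      (3 ∣ m ∧ ¬ 9 ∣ m ∧ (w : ZMod m) = 1 - 2 * ((m / 3 : ℕ) : ZMod m) ^ 2)) :
    (∀ w : (ZMod (3 ^ 1 * m))ˣ,
      (∀ χ : DirichletCharacter ℂ (3 ^ 1 * m), χ.IsPrimitive → χ w = 1) →
      (w : ZMod (3 ^ 1 * m)) = 1 ∨ (4 ∣ 3 ^ 1 * m ∧ 3 ∣ 3 ^ 1 * m ∧ ¬ 9 ∣ 3 ^ 1 * m ∧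
        (w : ZMod (3 ^ 1 * m)) = (((3 ^ 1 * m / 2 : ℕ) : ZMod (3 ^ 1 * m)) - 1) *
          (2 * ((3 ^ 1 * m / 3 : ℕ) : ZMod (3 ^ 1 * m)) ^ 2 - 1))) ∧
    (∀ w : (ZMod (3 ^ 1 * m))ˣ,
      (∀ χ : DirichletCharacter ℂ (3 ^ 1 * m), χ.IsPrimitive → χ w = -1) →
      (4 ∣ 3 ^ 1 * m ∧ (w : ZMod (3 ^ 1 * m)) = 1 + ((3 ^ 1 * m / 2 : ℕ) : ZMod (3 ^ 1 * m))) ∨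
      (3 ∣ 3 ^ 1 * m ∧ ¬ 9 ∣ 3 ^ 1 * m ∧
        (w : ZMod (3 ^ 1 * m)) = 1 - 2 * ((3 ^ 1 * m / 3 : ℕ) : ZMod (3 ^ 1 * m)) ^ 2)) := by
  classical
  haveI : NeZero (3 ^ 1 * m) := ⟨mul_ne_zero (by norm_num) (NeZero.ne m)⟩
  have hd : 3 ^ (1 - 1) ∣ 3 ^ 1 := pow_dvd_pow 3 (Nat.sub_le 1 1)
  have hprim : ∀ χ : DirichletCharacter ℂ (3 ^ 1), ¬ χ.FactorsThrough (3 ^ (1 - 1)) →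
      χ.IsPrimitive := fun χ hχ ↦ isPrimitive_of_not_factorsThrough_primePow Nat.prime_three le_rfl χ hχ
  have hu : ZMod.unitsMap hd (-1) = 1 := unitsMap_eq_one_of_eq_one hd (by norm_num) _
  have hu1 : ((-1 : (ZMod (3 ^ 1))ˣ) : ZMod (3 ^ 1)) ≠ 1 := by decide
  have hres : ∀ x : (ZMod (3 ^ 1 * m))ˣ,
      ZMod.castHom (dvd_mul_right (3 ^ 1) m) (ZMod (3 ^ 1)) (x : ZMod (3 ^ 1 * m)) = 1 ∨
      ZMod.castHom (dvd_mul_right (3 ^ 1) m) (ZMod (3 ^ 1)) (x : ZMod (3 ^ 1 * m)) =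
        ((-1 : (ZMod (3 ^ 1))ˣ) : ZMod (3 ^ 1)) := by
    intro x
    have h33 : ∀ a b : ZMod (3 ^ 1), a * b = 1 → a = 1 ∨ a = -1 := by decide
    rw [Units.val_neg, Units.val_one]
    refine h33 _ (ZMod.castHom (dvd_mul_right (3 ^ 1) m) (ZMod (3 ^ 1)) ((x⁻¹ : (ZMod (3 ^ 1 * m))ˣ) :
      ZMod (3 ^ 1 * m))) ?_
    rw [← map_mul, ← Units.val_mul, mul_inv_cancel, Units.val_one, map_one]
  have h93 : ¬ 9 ∣ 3 ^ 1 * m := fun h9 ↦ hm3 (by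
    have : 3 * 3 ∣ 3 * m := by simpa using h9
    exact Nat.dvd_of_mul_dvd_mul_left (by norm_num) this)
  have hdiv3 : 3 ^ 1 * m / 3 = m := by rw [pow_one, Nat.mul_div_cancel_left m (by norm_num)]
  have hq3 : ZMod.castHom (dvd_mul_right (3 ^ 1) m) (ZMod (3 ^ 1))
      (((3 ^ 1 * m / 3 : ℕ) : ZMod (3 ^ 1 * m))) ^ 2 = 1 := by
    rw [hdiv3, map_natCast]
    have := natCast_sq_three hm3
    exact this
  have hm3' : ZMod.castHom (dvd_mul_left m (3 ^ 1)) (ZMod m)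
      (((3 ^ 1 * m / 3 : ℕ) : ZMod (3 ^ 1 * m))) = 0 := by
    rw [hdiv3, map_natCast, ZMod.natCast_self]
  have h2m : 4 ∣ m → 2 ∣ m := fun h ↦ dvd_trans ⟨2, rfl⟩ h
  have h2half : ∀ _ : 2 ∣ m, (2 : ZMod m) * ((m / 2 : ℕ) : ZMod m) = 0 := fun h2 ↦ by
    rw [show (2 : ZMod m) = ((2 : ℕ) : ZMod m) by norm_cast, ← Nat.cast_mul,
      ZMod.natCast_eq_zero_iff, Nat.mul_div_cancel' h2]
  have hodd3 : Odd (3 ^ 1) := by decide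
  constructor
  · intro w hw
    rcases hres w with h1 | hm1
    · have hrec := two_point_recurse hcop hd hprim w (Or.inl rfl) hw h1 (-1) hu hu1
      rcases ih1 (ZMod.unitsMap (dvd_mul_left m (3 ^ 1)) w)
          (fun χ₂ hχ₂ ↦ by rw [coe_unitsMap]; exact hrec χ₂ hχ₂) with h1' | ⟨-, h3, -⟩
      · left
        exact eq_of_cast_eq_of_coprime hcop (by rw [h1, map_one])
          (by rw [map_one, ← coe_unitsMap, h1'])
      · exact absurd h3 hm3
    · have hrec := two_point_coset hcop hd hprim w (Or.inl rfl) hw (-1) hu hu1 hm1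
      rcases ih2 (ZMod.unitsMap (dvd_mul_left m (3 ^ 1)) w)
          (fun χ₂ hχ₂ ↦ by rw [coe_unitsMap]; exact hrec χ₂ hχ₂) with ⟨h4, hh⟩ | ⟨h3, -⟩
      · right
        refine ⟨dvd_mul_of_dvd_right h4 _, dvd_mul_of_dvd_left (dvd_pow_self 3 one_ne_zero) _, h93,
          eq_of_cast_eq_of_coprime hcop ?_ ?_⟩
        · rw [hm1, map_mul, castHom_left_uElt (h2m h4), map_sub, map_mul, map_pow, hq3, map_one,
            map_ofNat, Units.val_neg, Units.val_one]
          ring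
        · rw [map_mul, castHom_right_uElt hodd3 (h2m h4), map_sub, map_mul, map_pow, hm3', map_one,
            map_ofNat, ← coe_unitsMap, hh]
          linear_combination h2half (h2m h4)
      · exact absurd h3 hm3
  · intro w hw
    rcases hres w with h1 | hm1
    · have hrec := two_point_recurse hcop hd hprim w (Or.inr rfl) hw h1 (-1) hu hu1
      rcases ih2 (ZMod.unitsMap (dvd_mul_left m (3 ^ 1)) w)
          (fun χ₂ hχ₂ ↦ by rw [coe_unitsMap]; exact hrec χ₂ hχ₂) with ⟨h4, hh⟩ | ⟨h3, -⟩
      · left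
        refine ⟨dvd_mul_of_dvd_right h4 _, eq_of_cast_eq_of_coprime hcop ?_ ?_⟩
        · rw [h1, map_add, map_one, castHom_left_half (h2m h4), add_zero]
        · rw [map_add, map_one, castHom_right_half hodd3 (h2m h4), ← coe_unitsMap, hh]
      · exact absurd h3 hm3
    · have hrec := two_point_coset hcop hd hprim w (Or.inr rfl) hw (-1) hu hu1 hm1
      rcases ih1 (ZMod.unitsMap (dvd_mul_left m (3 ^ 1)) w)
          (fun χ₂ hχ₂ ↦ by rw [coe_unitsMap]; have := hrec χ₂ hχ₂; norm_num at this; exact this)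
          with h1' | ⟨-, h3, -⟩
      · right
        refine ⟨dvd_mul_of_dvd_left (dvd_pow_self 3 one_ne_zero) _, h93,
          eq_of_cast_eq_of_coprime hcop ?_ ?_⟩
        · rw [hm1, map_sub, map_one, map_mul, map_pow, hq3, map_ofNat, Units.val_neg, Units.val_one]
          ring
        · rw [map_sub, map_one, map_mul, map_pow, hm3', map_ofNat, ← coe_unitsMap, h1']
          ring
      · exact absurd h3 hm3

/-- One peeling step for `U*`/`U**` at the prime `2` (`4 ∣ n`). [cite: Aoki1983, §6] -/
theorem ustar_step_two {e m : ℕ} [NeZero m] (he2 : 2 ≤ e) (hmodd : Odd m)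
    (hcop : (2 ^ e).Coprime m)
    (ih1 : ∀ w : (ZMod m)ˣ, (∀ χ : DirichletCharacter ℂ m, χ.IsPrimitive → χ w = 1) →
      (w : ZMod m) = 1 ∨ (4 ∣ m ∧ 3 ∣ m ∧ ¬ 9 ∣ m ∧
        (w : ZMod m) = (((m / 2 : ℕ) : ZMod m) - 1) * (2 * ((m / 3 : ℕ) : ZMod m) ^ 2 - 1)))
    (ih2 : ∀ w : (ZMod m)ˣ, (∀ χ : DirichletCharacter ℂ m, χ.IsPrimitive → χ w = -1) →
      (4 ∣ m ∧ (w : ZMod m) = 1 + ((m / 2 : ℕ) : ZMod m)) ∨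
      (3 ∣ m ∧ ¬ 9 ∣ m ∧ (w : ZMod m) = 1 - 2 * ((m / 3 : ℕ) : ZMod m) ^ 2)) :
    (∀ w : (ZMod (2 ^ e * m))ˣ,
      (∀ χ : DirichletCharacter ℂ (2 ^ e * m), χ.IsPrimitive → χ w = 1) →
      (w : ZMod (2 ^ e * m)) = 1 ∨ (4 ∣ 2 ^ e * m ∧ 3 ∣ 2 ^ e * m ∧ ¬ 9 ∣ 2 ^ e * m ∧
        (w : ZMod (2 ^ e * m)) = (((2 ^ e * m / 2 : ℕ) : ZMod (2 ^ e * m)) - 1) *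
          (2 * ((2 ^ e * m / 3 : ℕ) : ZMod (2 ^ e * m)) ^ 2 - 1))) ∧
    (∀ w : (ZMod (2 ^ e * m))ˣ,
      (∀ χ : DirichletCharacter ℂ (2 ^ e * m), χ.IsPrimitive → χ w = -1) →
      (4 ∣ 2 ^ e * m ∧ (w : ZMod (2 ^ e * m)) = 1 + ((2 ^ e * m / 2 : ℕ) : ZMod (2 ^ e * m))) ∨
      (3 ∣ 2 ^ e * m ∧ ¬ 9 ∣ 2 ^ e * m ∧
        (w : ZMod (2 ^ e * m)) = 1 - 2 * ((2 ^ e * m / 3 : ℕ) : ZMod (2 ^ e * m)) ^ 2)) := by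
  classical
  haveI : NeZero (2 ^ e) := ⟨pow_ne_zero e two_ne_zero⟩
  haveI : NeZero (2 ^ (e - 1)) := ⟨pow_ne_zero _ two_ne_zero⟩
  haveI : NeZero (2 ^ e * m) := ⟨mul_ne_zero (NeZero.ne _) (NeZero.ne m)⟩
  have he1 : 1 ≤ e := by omega
  have hd : 2 ^ (e - 1) ∣ 2 ^ e := pow_dvd_pow 2 (Nat.sub_le e 1)
  have hprim : ∀ χ : DirichletCharacter ℂ (2 ^ e), ¬ χ.FactorsThrough (2 ^ (e - 1)) →
      χ.IsPrimitive := fun χ hχ ↦ isPrimitive_of_not_factorsThrough_primePow Nat.prime_two he1 χ hχ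
  -- the non-trivial kernel element `z = 1 + 2^(e-1)`
  obtain ⟨z, hz, hz1⟩ : ∃ z : (ZMod (2 ^ e))ˣ, ZMod.unitsMap hd z = 1 ∧ z ≠ 1 := by
    have hcard := totient_mul_card_ker (q := 2 ^ e) hd
    rw [Nat.totient_prime_pow Nat.prime_two (by omega),
      Nat.totient_prime_pow Nat.prime_two (by omega)] at hcard
    have hpow : 2 ^ (e - 1) = 2 ^ (e - 1 - 1) * 2 := by rw [← pow_succ]; congr 1; omega
    have h2 : #(univ.filter fun u : (ZMod (2 ^ e))ˣ ↦ ZMod.unitsMap hd u = 1) = 2 := by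
      have hpos : 0 < 2 ^ (e - 1 - 1) := pow_pos (by norm_num) _
      simp only [Nat.add_one_sub_one, mul_one] at hcard
      conv at hcard => rhs; rw [hpow]
      exact Nat.eq_of_mul_eq_mul_left hpos hcard
    obtain ⟨z, hzm, hz1⟩ := Finset.exists_mem_ne (s := univ.filter fun u : (ZMod (2 ^ e))ˣ ↦
      ZMod.unitsMap hd u = 1) (by rw [h2]; norm_num) 1
    simp only [Finset.mem_filter, Finset.mem_univ, true_and] at hzm
    exact ⟨z, hzm, hz1⟩
  have hz1' : (z : ZMod (2 ^ e)) ≠ 1 := fun h ↦ hz1 (Units.ext h)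
  have hzval : (z : ZMod (2 ^ e)) = 1 + ((2 ^ (e - 1) : ℕ) : ZMod (2 ^ e)) := by
    rcases coe_eq_of_unitsMap_eq_one_double hd (by rw [← pow_succ]; congr 1; omega)
      (lt_of_lt_of_le one_lt_two (Nat.le_self_pow (by omega) 2)) z hz with h | h
    · exact absurd h hz1'
    · exact h
  have h4 : 4 ∣ 2 ^ e * m := by
    have : 2 ^ 2 ∣ 2 ^ e := pow_dvd_pow 2 he2
    exact dvd_mul_of_dvd_left (by simpa using this) m
  have hm4 : ¬ 4 ∣ m := fun h ↦ (Nat.not_even_iff_odd.mpr hmodd)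
    (even_iff_two_dvd.mpr (dvd_trans ⟨2, rfl⟩ h))
  have h9n : 3 ∣ m → ¬ 9 ∣ m → ¬ 9 ∣ 2 ^ e * m := fun _ h9 h9n ↦ by
    have hc' : Nat.Coprime 9 (2 ^ e) := Nat.Coprime.pow_right e (by norm_num)
    exact h9 (hc'.dvd_of_dvd_mul_left h9n)
  constructor
  · intro w hw
    by_cases hwq : ZMod.castHom (dvd_mul_right (2 ^ e) m) (ZMod (2 ^ e)) (w : ZMod (2 ^ e * m)) = 1
    · have hrec := two_point_recurse hcop hd hprim w (Or.inl rfl) hw hwq z hz hz1'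
      rcases ih1 (ZMod.unitsMap (dvd_mul_left m (2 ^ e)) w)
          (fun χ₂ hχ₂ ↦ by rw [coe_unitsMap]; exact hrec χ₂ hχ₂) with h1' | ⟨h4m, -⟩
      · left
        exact eq_of_cast_eq_of_coprime hcop (by rw [hwq, map_one])
          (by rw [map_one, ← coe_unitsMap, h1'])
      · exact absurd h4m hm4
    by_cases hwz : ZMod.castHom (dvd_mul_right (2 ^ e) m) (ZMod (2 ^ e)) (w : ZMod (2 ^ e * m)) = z
    · have hrec := two_point_coset hcop hd hprim w (Or.inl rfl) hw z hz hz1' hwz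
      rcases ih2 (ZMod.unitsMap (dvd_mul_left m (2 ^ e)) w)
          (fun χ₂ hχ₂ ↦ by rw [coe_unitsMap]; exact hrec χ₂ hχ₂) with ⟨h4m, -⟩ | ⟨h3, h9, hv⟩
      · exact absurd h4m hm4
      · right
        refine ⟨h4, dvd_mul_of_dvd_right h3 _, h9n h3 h9, eq_of_cast_eq_of_coprime hcop ?_ ?_⟩
        · rw [hwz, map_mul, castHom_two_pow_uElt he1 hmodd, castHom_left_vElt h3, hzval]; ring
        · rw [map_mul, map_sub, map_one, castHom_two_pow_half_right he1, castHom_right_vElt hcop h3,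
            ← coe_unitsMap, hv]
          ring
    · exfalso
      exact two_point_false hcop hd hprim (Or.inl hmodd) w (Or.inl rfl) hw hwq z hz hz1'
        (Ne.symm hwz)
  · intro w hw
    by_cases hwq : ZMod.castHom (dvd_mul_right (2 ^ e) m) (ZMod (2 ^ e)) (w : ZMod (2 ^ e * m)) = 1
    · have hrec := two_point_recurse hcop hd hprim w (Or.inr rfl) hw hwq z hz hz1'
      rcases ih2 (ZMod.unitsMap (dvd_mul_left m (2 ^ e)) w)
          (fun χ₂ hχ₂ ↦ by rw [coe_unitsMap]; exact hrec χ₂ hχ₂) with ⟨h4m, -⟩ | ⟨h3, h9, hv⟩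
      · exact absurd h4m hm4
      · right
        refine ⟨dvd_mul_of_dvd_right h3 _, h9n h3 h9, eq_of_cast_eq_of_coprime hcop ?_ ?_⟩
        · rw [hwq, map_sub, map_one, map_mul, map_pow, castHom_left_third h3, map_ofNat]; ring
        · rw [map_sub, map_one, map_mul, map_ofNat, castHom_right_third_sq hcop h3, ← coe_unitsMap,
            hv]
    by_cases hwz : ZMod.castHom (dvd_mul_right (2 ^ e) m) (ZMod (2 ^ e)) (w : ZMod (2 ^ e * m)) = z
    · have hrec := two_point_coset hcop hd hprim w (Or.inr rfl) hw z hz hz1' hwz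
      rcases ih1 (ZMod.unitsMap (dvd_mul_left m (2 ^ e)) w)
          (fun χ₂ hχ₂ ↦ by rw [coe_unitsMap]; have := hrec χ₂ hχ₂; norm_num at this; exact this)
          with h1' | ⟨h4m, -⟩
      · left
        refine ⟨h4, eq_of_cast_eq_of_coprime hcop ?_ ?_⟩
        · rw [hwz, map_add, map_one, castHom_two_pow_half he1 hmodd, hzval]
        · rw [map_add, map_one, castHom_two_pow_half_right he1, ← coe_unitsMap, h1', add_zero]
      · exact absurd h4m hm4
    · exfalso
      exact two_point_false hcop hd hprim (Or.inl hmodd) w (Or.inr rfl) hw hwq z hz hz1'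
        (Ne.symm hwz)

/-- **`U*(n) = {1, uv}` and `U**(n) = {-u, -v}`** (the units on which ALL primitive characters
mod `n` take the value `1`, resp. `-1`; `n` odd or `4 ∣ n`; `u = n/2 - 1` when `4 ∣ n`,
`v = 2(n/3)² - 1` when `3 ∥ n`), by the peeling induction. [cite: Aoki1983, §6] -/
theorem ustar_aux (n : ℕ) (hn0 : n ≠ 0) (hval : Odd n ∨ 4 ∣ n) :
    (∀ w : (ZMod n)ˣ, (∀ χ : DirichletCharacter ℂ n, χ.IsPrimitive → χ w = 1) →
      (w : ZMod n) = 1 ∨ (4 ∣ n ∧ 3 ∣ n ∧ ¬ 9 ∣ n ∧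
        (w : ZMod n) = (((n / 2 : ℕ) : ZMod n) - 1) * (2 * ((n / 3 : ℕ) : ZMod n) ^ 2 - 1))) ∧
    (∀ w : (ZMod n)ˣ, (∀ χ : DirichletCharacter ℂ n, χ.IsPrimitive → χ w = -1) →
      (4 ∣ n ∧ (w : ZMod n) = 1 + ((n / 2 : ℕ) : ZMod n)) ∨
      (3 ∣ n ∧ ¬ 9 ∣ n ∧ (w : ZMod n) = 1 - 2 * ((n / 3 : ℕ) : ZMod n) ^ 2)) := by
  classical
  induction n using Nat.strong_induction_on with
  | _ n ih =>
  haveI : NeZero n := ⟨hn0⟩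
  -- level 1
  by_cases hn1 : n = 1
  · subst hn1
    refine ⟨fun w _ ↦ Or.inl (Subsingleton.elim _ _), fun w hw ↦ ?_⟩
    have h1p : (1 : DirichletCharacter ℂ 1).IsPrimitive := by
      rw [DirichletCharacter.isPrimitive_def, DirichletCharacter.conductor_one]
    have := hw 1 h1p
    rw [MulChar.one_apply_coe] at this
    norm_num at this
  /- choose a prime `p ∣ n` to peel: `2` if `n` is even; `3` if `3 ∥ n`; otherwise any prime,
  which then has a kernel with at least three elements -/
  obtain ⟨p, hp, hpn, hchoice⟩ : ∃ p, p.Prime ∧ p ∣ n ∧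
      (p = 2 ∨ (p = 3 ∧ ¬ 9 ∣ n ∧ ¬ 2 ∣ n) ∨ (p ≠ 2 ∧ (p = 3 → 9 ∣ n))) := by
    by_cases h2 : 2 ∣ n
    · exact ⟨2, Nat.prime_two, h2, Or.inl rfl⟩
    by_cases h3 : 3 ∣ n ∧ ¬ 9 ∣ n
    · exact ⟨3, Nat.prime_three, h3.1, Or.inr (Or.inl ⟨rfl, h3.2, h2⟩)⟩
    · refine ⟨n.minFac, Nat.minFac_prime hn1, Nat.minFac_dvd n, Or.inr (Or.inr ⟨?_, ?_⟩)⟩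
      · intro h; exact h2 (h ▸ Nat.minFac_dvd n)
      · intro h
        by_contra h9
        exact h3 ⟨h ▸ Nat.minFac_dvd n, h9⟩
  -- decompose `n = p^e * m`
  obtain ⟨e, he⟩ : ∃ e, n.factorization p = e := ⟨_, rfl⟩
  have he1 : 1 ≤ e := he ▸ hp.factorization_pos_of_dvd hn0 hpn
  have hcop0 : Nat.Coprime p (n / p ^ e) := he ▸ Nat.coprime_ordCompl hp hn0
  have h9e : p = 3 → 9 ∣ n → 2 ≤ e := fun h3 h9 ↦ by
    subst h3
    exact he ▸ (Nat.prime_three.pow_dvd_iff_le_factorization hn0).mp (by norm_num; exact h9)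
  have h4e : p = 2 → 4 ∣ n → 2 ≤ e := fun h2 h4 ↦ by
    subst h2
    exact he ▸ (Nat.prime_two.pow_dvd_iff_le_factorization hn0).mp (by norm_num; exact h4)
  obtain ⟨m, rfl⟩ : ∃ m, n = p ^ e * m :=
    ⟨n / p ^ e, by rw [← he]; exact (Nat.ordProj_mul_ordCompl_eq_self n p).symm⟩
  have hpe0 : p ^ e ≠ 0 := pow_ne_zero e hp.ne_zero
  have hm0 : m ≠ 0 := fun h0 ↦ hn0 (by rw [h0, mul_zero])
  haveI : NeZero m := ⟨hm0⟩
  haveI : NeZero (p ^ e) := ⟨hpe0⟩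
  have hdiv : p ^ e * m / p ^ e = m := Nat.mul_div_cancel_left m (Nat.pos_of_ne_zero hpe0)
  rw [hdiv] at hcop0
  have hcop : (p ^ e).Coprime m := Nat.Coprime.pow_left e hcop0
  have hq1 : 1 < p ^ e := lt_of_lt_of_le hp.one_lt (Nat.le_self_pow (by omega) p)
  have hlt : m < p ^ e * m := (Nat.lt_mul_iff_one_lt_left (Nat.pos_of_ne_zero hm0)).mpr hq1
  have hpm : ¬ p ∣ m := fun hd ↦ by
    have := Nat.Coprime.coprime_dvd_right hd hcop0
    rw [Nat.coprime_self] at this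
    exact hp.one_lt.ne' this
  -- validity of `m` and the induction hypothesis
  have hmval : Odd m ∨ 4 ∣ m := by
    by_cases hp2 : p = 2
    · subst hp2
      left
      exact Nat.odd_iff.mpr (by omega)
    · rcases hval with ho | h4
      · exact Or.inl (Nat.Odd.of_mul_right ho)
      · right
        have hc' : Nat.Coprime (2 ^ 2) (p ^ e) :=
          Nat.Coprime.pow 2 e ((Nat.coprime_primes Nat.prime_two hp).mpr (Ne.symm hp2))
        exact (show Nat.Coprime 4 (p ^ e) by simpa using hc').dvd_of_dvd_mul_left h4
  obtain ⟨ih1, ih2⟩ := ih m hlt hm0 hmval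
  rcases hchoice with hp2 | ⟨hp3, h9, h2⟩ | ⟨hp2, hp39⟩
  · -- `p = 2`
    subst hp2
    have h4' : 4 ∣ 2 ^ e * m := by
      rcases hval with ho | h4
      · exfalso
        exact (Nat.not_even_iff_odd.mpr ho) (even_iff_two_dvd.mpr
          (dvd_trans (dvd_pow_self 2 (by omega)) (dvd_mul_right _ _)))
      · exact h4
    have hmodd : Odd m := Nat.odd_iff.mpr (by omega)
    exact ustar_step_two (h4e rfl h4') hmodd hcop ih1 ih2
  · -- `p = 3`, `3 ∥ n`
    subst hp3
    have he1' : e = 1 := by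
      by_contra hne
      exact h9 (dvd_trans (by norm_num : 9 ∣ 3 ^ 2)
        (dvd_trans (pow_dvd_pow 3 (by omega : 2 ≤ e)) (dvd_mul_right _ _)))
    subst he1'
    exact ustar_step_three hpm hcop ih1 ih2
  · -- the big kernel case
    have hker : 3 ≤ #(univ.filter fun u : (ZMod (p ^ e))ˣ ↦
        ZMod.unitsMap (pow_dvd_pow p (Nat.sub_le e 1)) u = 1) := by
      rcases Nat.lt_or_ge e 2 with he2 | he2
      · have he1' : e = 1 := by omega
        subst he1'
        have hp3 : p ≠ 3 := fun h ↦ by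
          have := h9e h (hp39 h); omega
        have hp5 : 5 ≤ p := by
          by_contra hlt
          push Not at hlt
          interval_cases p <;> first | exact absurd rfl hp2 | exact absurd rfl hp3 |
            exact absurd hp (by decide)
        rw [Finset.filter_true_of_mem (fun u _ ↦ unitsMap_eq_one_of_eq_one _ (by simp) u),
          Finset.card_univ, ZMod.card_units_eq_totient, pow_one, Nat.totient_prime hp]
        omega
      · rw [card_ker_primePow hp he2]
        have := hp.two_le; omega
    exact ustar_step_big hp hp2 he1 hcop hmval hker ih1 ih2

/-- **`U*(n) ⊆ {1, uv}`**: a unit on which every primitive character mod `n` (`n` odd or `4 ∣ n`)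
is `1` equals `1` or `uv` (the latter only when `12 ∣ n`, `9 ∤ n`). [cite: Aoki1983, §6] -/
theorem coe_eq_of_forall_isPrimitive_eq_one {n : ℕ} [NeZero n] (hval : Odd n ∨ 4 ∣ n)
    (w : (ZMod n)ˣ) (hw : ∀ χ : DirichletCharacter ℂ n, χ.IsPrimitive → χ w = 1) :
    (w : ZMod n) = 1 ∨ (4 ∣ n ∧ 3 ∣ n ∧ ¬ 9 ∣ n ∧
      (w : ZMod n) = (((n / 2 : ℕ) : ZMod n) - 1) * (2 * ((n / 3 : ℕ) : ZMod n) ^ 2 - 1)) :=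
  (ustar_aux n (NeZero.ne n) hval).1 w hw

/-- **`U**(n) ⊆ {-u, -v}`**: a unit on which every primitive character mod `n` is `-1` equals
`1 + n/2` (`4 ∣ n`) or `1 - 2(n/3)²` (`3 ∥ n`). [cite: Aoki1983, §6] -/
theorem coe_eq_of_forall_isPrimitive_eq_neg_one {n : ℕ} [NeZero n] (hval : Odd n ∨ 4 ∣ n)
    (w : (ZMod n)ˣ) (hw : ∀ χ : DirichletCharacter ℂ n, χ.IsPrimitive → χ w = -1) :
    (4 ∣ n ∧ (w : ZMod n) = 1 + ((n / 2 : ℕ) : ZMod n)) ∨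
    (3 ∣ n ∧ ¬ 9 ∣ n ∧ (w : ZMod n) = 1 - 2 * ((n / 3 : ℕ) : ZMod n) ^ 2) :=
  (ustar_aux n (NeZero.ne n) hval).2 w hw

end UStar

end FermatCharacter

end Literature.AlgebraicGeometry.HodgeTheory
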